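import Summits.ABC.IUTFork.Cor312LicenceTripleHullCellRefuteTame
import Summits.ABC.IUTFork.Conditional.RefBandsExactCellLinear
import Summits.ABC.ABC.Theorems.DeepRegimeABC.Negative.ConstFreeFloors
import HarnessLib

/-!
# R-W «W:REF-BANDS-EXACT»: the Browkin–Brzeziński triple `19·1307 + 7·29²·31⁸ = 2⁸·3²²·5⁴` — the hull-level clause S_H is REFUTED at EVERY genuine
# Θ-volume datum over `(ratPoint (a/c), l)` for EVERY prime `7 ≤ l ≤ 59273`, `l ≠ 31`, with NO local-type hypothesis (exact class at `p = 31`)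

PROOF-ONLY file (D-0012: 0 definitions, 0 `Prop` facts, no instance, no notation) of the abc-iut cell — D-0079 RESCUE sub-cell R-W «WINDOW Θ-SIDE
INEQUALITY», numerics-crew seat abc-iut-W-num-6 (gen 4), row «W:REF-BANDS-EXACT» (abc-iut-plan g11 C-R84 (b) «one DATUM-BAND per seat … open for MINE»,
C-R88 (a); this seat's MINE 04:50Z «19·1307-triple»). TAKES NO SIDE on [IUTchIII] Cor. 3.12 (S. Mochizuki, *Inter-universal Teichmüller theory III*, RIMS
manuscript, Cor. 3.12 p. 173–174, Step (xi-f) p. 184) or on any author.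

ENGINE (BY NAME): abc-iut-W-neg-1 g4's `GenuineK.not_pilotKummerCompatHull_chosen_triple_of_hullCells_tame` (`Cor312LicenceTripleHullCellRefuteTame`):
abc triple, genuine datum `T` over `(ratPoint (a/c), l)`, TAME pole prime `p ∉ {2,3,5,l}` with `p^v ∥ abc`, label `i + 1 ≤ l⋆`; class lemma
`e(K_{x₀}/ℚ_p) = A·l`, `A ∣ 30`, `15 ∣ A·v`, `Even v → A ∣ 15`; if R-H row 4's cell `HullCell (A·l) (A·v) (i+1) (⌊A·l/(p−1)⌋+1) (p^{a₀} − a₀·A·l)` FAILS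
for every class member then `Cor312Vol.PilotKummerCompatHull` FAILS at `settingPrVolSharp (pilotDataOfK T.D T.K) …` (chosen realising ideles, pinned
reading, every free binder). HERE `p = 31` (`31⁸ ∥ abc`, `v = 8` EVEN and prime to `15` ⇒ the SINGLE type `A = 15`, `e = 15·l`, `P_q = 120`; note
`p − 1 = 30` so `⌊15l/30⌋ = l⋆`):
* `RefBand.cells_24833` — the engine's `hcell` at every odd `7 ≤ l ≤ 59221`: pieces `a₀ = 1` (`l ≤ 62`), `a₀ = 2` (`63 ≤ l ≤ 1922`), `a₀ = 3`
  (`1923 ≤ l ≤ 59221`) by the LINEAR closed form `RefBand.not_hullCell_of_linear'` (this seat, p496042; `(α, β) = (60, −119), (30, 796), (0, 29611)`;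
  the last reads `30·l < 1776660`);
* `RefBand.cells_24833_levels` — the five further primes `l ∈ {59233, 59239, 59243, 59263, 59273}` where the floor-free certificate fails but the
  top-label cell with its EXACT floor still fails (closed integer evaluations); at `l = 59281` the cell holds (not refuted by this route);
* **`GenuineK.not_pilotKummerCompatHull_chosen_triple_24833_band`** — the band theorem: EVERY prime `7 ≤ l ≤ 59273`, `l ≠ 31`, EVERY `T`, top label.
It supersedes in range this seat's gen-2 e-free [LIN] band `GenuineK.not_pilotKummerCompatHull_chosen_frey24833_band` (`l ≤ 960`, p472576) and covers the
triple's tabulated Szpiro-bad levels (`l ≤ 397`). NUMERICS OF RECORD (two engines): the R-W lead's REF-BANDS-EXACT-CERTS.tsv row «31 8 15 7 59221» and this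
seat's HOME/abc-iut-W-num-6/refbands/CLOSED-FORMS.tsv (0/2,385,320 mismatches) + UND-AT-PRIMES.tsv: the lead's floor-free INHABITED certificate holds from the
prime `59333` on, so after this band the certificate-level residue of the triple is the single prime `l = 59281` (exact cells per level, not claimed here).
HONEST SCOPE as in the engine: SHARP reading; per-label licence STRONGER than print; admissibility / Szpiro-badness / (P6) of `(ratPoint (a/c), l)` and
non-emptiness of the datum type NOT claimed (a «∀ T» statement is vacuous if no datum exists); «refuted as typed» ≠ «refuted in print»; nothing about the
number-level `Cor22.Cor312AtDatum` or any author's intended hull; typed ≠ proved; instantiated ≠ endorsed; no abc claim.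
[cite: Mochizuki2012, IUTchIII Cor. 3.12 Step (xi-f) p. 184; IUTchIV Prop. 1.1 p. 9, Prop. 1.2 (i)(ii) p. 10, Thm. 1.10 p. 22, Cor. 2.2 (ii) proof (P5) p. 46]
[cite: DupuyHilado2025, §3.4, §4.9, §4.12] [cite: SerreLocalFields1979, Ch. III §6 Prop. 13] [cite: NeukirchANT1999, Ch. II (5.5)]
[cite: SilvermanATAEC1994, V.5 Thm. 5.3 and Cor. 5.4] [cite: BrowkinBrzezinski1994, Table 1] [claim: Mochizuki2012, status: disputed] for every IUT sentence quoted.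
-/

noncomputable section

open Set Function NumberField IsDedekindDomain

namespace Summit.ABC.IUTFork.Conditional

open Thm311 Thm311.Real Cor312 Cor312Vol Cor312Prov Literature.IUT.LogThetaLattice Literature.IUT.LogVolume
  Literature.IUT.HodgeTheaters Literature.IUT.LogVolume.ThetaData Literature.IUT.LogVolume.Cor22
open Literature.NumberTheory.NumberFields Literature.NumberTheory.GaloisRepresentations.Ultrametric
open Literature.NumberTheory.DiophantineGeometry Literature.NumberTheory.DiophantineGeometry.GenEll Summit.ABC.ABC.Theorems
open Summit.ABC.IUTFork.Repair.RH.HullThresholdExact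

/-! ## §1. The integer side at `p = 31`, `e = 15·l`, `P_q = 120`: three linear pieces and five exact levels -/

/-- **The five exact levels past the floor-free end**: at `l ∈ {59233, 59239, 59243, 59263, 59273}` (`j = l⋆`) the top-label cell
`HullCell (15l) 120 j (⌊15l/30⌋+1) (31³ − 3·15l)` FAILS (closed integer evaluations with the exact floor; the floor-free margin is negative there). [folklore] -/
theorem RefBand.cells_24833_levels {l : ℕ} (hl : l ∈ [59233, 59239, 59243, 59263, 59273]) :
    ¬ HullCell ((15 * l : ℕ) : ℤ) ((15 * 8 : ℕ) : ℤ) ((((l - 1) / 2 - 1 : ℕ) : ℤ) + 1) (((15 * l) / ((31 : ℕ) - 1) + 1 : ℕ) : ℤ)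
      (((31 : ℕ) : ℤ) ^ 3 - ((3 : ℕ) : ℤ) * ((15 * l : ℕ) : ℤ)) := by
  simp only [List.mem_cons, List.not_mem_nil, or_false] at hl
  unfold HullCell
  rcases hl with rfl | rfl | rfl | rfl | rfl <;> norm_num

/-- **The engine's `hcell` for the Browkin–Brzeziński triple at `p = 31` (`v = 8`), every odd `7 ≤ l ≤ 59273`, top label `i + 1 = l⋆`.** The class clauses
force `A = 15`; turning points `a₀ = 1` (`l ≤ 62`), `2` (`63 ≤ l ≤ 1922`), `3` (`l ≥ 1923`); the cell fails by `RefBand.not_hullCell_of_linear'`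
(`(α,β) = (60,−119), (30,796), (0,29611)`) up to `l ≤ 59221` and at the five exact levels by `RefBand.cells_24833_levels`. [folklore] -/
theorem RefBand.cells_24833 {l : ℕ} (hlo : 7 ≤ l) (hhi : l ≤ 59273) (hodd : Odd l) (hx : l ≤ 59221 ∨ l ∈ [59233, 59239, 59243, 59263, 59273])
    {i : ℕ} (hi : i + 1 = (l - 1) / 2)
    (A : ℕ) (_hA30 : A ∣ 30) (hA15 : 15 ∣ A * 8) (hAev : Even 8 → A ∣ 15) :
    ∃ a₀ : ℕ, (∀ s : ℕ, s < a₀ → (1 : ℤ) * ((31 : ℕ) : ℤ) ^ s * (((31 : ℕ) : ℤ) - 1) < ((A * l : ℕ) : ℤ)) ∧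
      ((A * l : ℕ) : ℤ) ≤ 1 * ((31 : ℕ) : ℤ) ^ a₀ * (((31 : ℕ) : ℤ) - 1) ∧
      ¬ HullCell ((A * l : ℕ) : ℤ) ((A * 8 : ℕ) : ℤ) ((i : ℤ) + 1) (((A * l) / ((31 : ℕ) - 1) + 1 : ℕ) : ℤ)
        (((31 : ℕ) : ℤ) ^ a₀ - (a₀ : ℤ) * ((A * l : ℕ) : ℤ)) := by
  have hA : A = 15 := Nat.dvd_antisymm (hAev ⟨4, rfl⟩) ((by norm_num : Nat.Coprime 15 8).dvd_of_dvd_mul_right hA15)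
  subst hA
  obtain ⟨j, hj⟩ := hodd
  have hij : (i : ℤ) + 1 = (j : ℤ) := by
    have : i + 1 = j := by omega
    exact_mod_cast this
  have hlj : (l : ℤ) = 2 * (j : ℤ) + 1 := by exact_mod_cast hj
  have hcast : (((15 * l) / ((31 : ℕ) - 1) + 1 : ℕ) : ℤ) = (15 : ℤ) * (l : ℤ) / ((31 : ℤ) - 1) + 1 := by
    push_cast [Int.natCast_div]
    norm_num
  by_cases h62 : l ≤ 62
  · refine ⟨1, fun s hs => ?_, ?_, ?_⟩
    · interval_cases s; push_cast; omega
    · push_cast; omega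
    · rw [hij, hcast]
      have h := RefBand.not_hullCell_of_linear' (ev := 15) (v := 8) (p := 31) (a := 1) (pa := 31) (l := (l : ℤ)) (j := (j : ℤ))
        (e := ((15 * l : ℕ) : ℤ)) (m := ((15 * 8 : ℕ) : ℤ)) (by norm_num) (by norm_num) (by positivity) hlj (by push_cast; ring)
        (by norm_num) (by push_cast; omega)
      simpa using h
  · by_cases h1922 : l ≤ 1922
    · refine ⟨2, fun s hs => ?_, ?_, ?_⟩
      · interval_cases s <;> push_cast <;> omega
      · push_cast; omega
      · rw [hij, hcast]
        have h := RefBand.not_hullCell_of_linear' (ev := 15) (v := 8) (p := 31) (a := 2) (pa := 961) (l := (l : ℤ)) (j := (j : ℤ))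
          (e := ((15 * l : ℕ) : ℤ)) (m := ((15 * 8 : ℕ) : ℤ)) (by norm_num) (by norm_num) (by positivity) hlj (by push_cast; ring)
          (by norm_num) (by push_cast; omega)
        simpa using h
    · refine ⟨3, fun s hs => ?_, ?_, ?_⟩
      · interval_cases s <;> push_cast <;> omega
      · push_cast; omega
      · rcases hx with h59221 | hlev
        · rw [hij, hcast]
          have h := RefBand.not_hullCell_of_linear' (ev := 15) (v := 8) (p := 31) (a := 3) (pa := 29791) (l := (l : ℤ)) (j := (j : ℤ))
            (e := ((15 * l : ℕ) : ℤ)) (m := ((15 * 8 : ℕ) : ℤ)) (by norm_num) (by norm_num) (by positivity) hlj (by push_cast; ring)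
            (by norm_num) (by push_cast; omega)
          simpa using h
        · have hi' : i = (l - 1) / 2 - 1 := by omega
          subst hi'
          have h := RefBand.cells_24833_levels hlev
          exact h

/-! ## §2. THE BAND: the Browkin–Brzeziński triple refuted at every prime `7 ≤ l ≤ 59273`, `l ≠ 31` -/

/-- **R-W «W:REF-BANDS-EXACT» — the Browkin–Brzeziński triple `19·1307 + 7·29²·31⁸ = 2⁸·3²²·5⁴` REFUTED (S_H level) at EVERY prime `7 ≤ l ≤ 59273`,
`l ≠ 31`, UNCONDITIONALLY and UNIFORMLY in `l`.** For every such prime `l` and EVERY genuine Θ-volume datum `T` over `(ratPoint (a/c), l)`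
([IUTchIV] Cor. 2.2 (ii) proof (P7)), `Cor312Vol.PilotKummerCompatHull` at `settingPrVolSharp (pilotDataOfK T.D T.K) …` with the CHOSEN realising ideles
and the PINNED reading FAILS for every choice of the free context binders and Kummer datum: abc-iut-W-neg-1's engine at `p = 31` (`31 ∉ {2,3,5,l}`,
`31⁸ ∥ abc` ⇒ single class `e = 15·l`, `P_q = 120`), top label, `RefBand.cells_24833`. [cite: Mochizuki2012, IUTchIII Cor. 3.12 Step (xi-f) p. 184;
IUTchIV Thm. 1.10 p. 22, Cor. 2.2 (ii) proof (P5) p. 46] [cite: DupuyHilado2025, §3.4, §4.9, §4.12] [cite: BrowkinBrzezinski1994, Table 1]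
[claim: Mochizuki2012, status: disputed] -/
theorem GenuineK.not_pilotKummerCompatHull_chosen_triple_24833_band {l : ℕ} (hl : l.Prime) (hlo : 7 ≤ l) (hhi : l ≤ 59273) (hne : l ≠ 31)
    (T : Cor22.ThetaVolumeDatumAt (ratPoint (((19 * 1307 : ℕ) : ℚ) / (2 ^ 8 * 3 ^ 22 * 5 ^ 4 : ℕ))) l) :
    letI := T.instFieldF; letI := T.instNumberFieldF; letI := T.instAlgebraF; letI := T.instFieldK
    letI := T.instNumberFieldK; letI := T.instAlgebraK; letI := T.instFieldFbar; letI := T.instAlgebraFbar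
    letI := T.instAlgebraKFbar; letI := T.instIsElliptic
    ∀ (M : Type) [Field M] [NumberField M]
      (archPk : ∀ (j : (thetaIndex (pilotDataOfK T.D T.K)).Label) (vQ : (thetaIndex (pilotDataOfK T.D T.K)).VQ),
        Set ((logShellsDH (pilotDataOfK T.D T.K) (analyticLogv T.K)).Packet j vQ))
      (archSub : ∀ (j : (thetaIndex (pilotDataOfK T.D T.K)).Label) (v : (thetaIndex (pilotDataOfK T.D T.K)).V),
        Set ((logShellsDH (pilotDataOfK T.D T.K) (analyticLogv T.K)).Packet j ((thetaIndex (pilotDataOfK T.D T.K)).over v)))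
      (Ψ : ℤ → ∀ v : (thetaIndex (pilotDataOfK T.D T.K)).V, v ∈ (thetaIndex (pilotDataOfK T.D T.K)).Vbad →
        Set ((logShellsDH (pilotDataOfK T.D T.K) (analyticLogv T.K)).StarPacket v))
      (act : ℤ → ∀ v : (thetaIndex (pilotDataOfK T.D T.K)).V, v ∈ (thetaIndex (pilotDataOfK T.D T.K)).Vbad →
        (logShellsDH (pilotDataOfK T.D T.K) (analyticLogv T.K)).StarPacket v →
          Module.End ℚ ((logShellsDH (pilotDataOfK T.D T.K) (analyticLogv T.K)).StarPacket v))
      (Mmod : ℤ → ∀ j : (thetaIndex (pilotDataOfK T.D T.K)).LabelStar, Set ((logShellsDH (pilotDataOfK T.D T.K) (analyticLogv T.K)).GlobalPacket j.1))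
      (region : ℤ → ∀ j : (thetaIndex (pilotDataOfK T.D T.K)).LabelStar, FinDivisor M → ∀ vQ : (thetaIndex (pilotDataOfK T.D T.K)).VQ,
        Set ((logShellsDH (pilotDataOfK T.D T.K) (analyticLogv T.K)).Packet j.1 vQ))
      (frobAdm : ℤ → ℤ → ∀ (j : (thetaIndex (pilotDataOfK T.D T.K)).Label) (vQ : (thetaIndex (pilotDataOfK T.D T.K)).VQ),
        Set ((logShellsDH (pilotDataOfK T.D T.K) (analyticLogv T.K)).Packet j vQ) → Prop)
      (frobLogvol : ℤ → ℤ → ∀ (j : (thetaIndex (pilotDataOfK T.D T.K)).Label) (vQ : (thetaIndex (pilotDataOfK T.D T.K)).VQ),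
        Set ((logShellsDH (pilotDataOfK T.D T.K) (analyticLogv T.K)).Packet j vQ) → ℝ)
      (frobΨ : ℤ → ℤ → ∀ v : (thetaIndex (pilotDataOfK T.D T.K)).V, v ∈ (thetaIndex (pilotDataOfK T.D T.K)).Vbad →
        Set ((logShellsDH (pilotDataOfK T.D T.K) (analyticLogv T.K)).StarPacket v))
      (frobMmod : ℤ → ℤ → ∀ j : (thetaIndex (pilotDataOfK T.D T.K)).LabelStar, Set ((logShellsDH (pilotDataOfK T.D T.K) (analyticLogv T.K)).GlobalPacket j.1))
      (unitImage : ℤ → ℤ → ℕ → ∀ (j : (thetaIndex (pilotDataOfK T.D T.K)).Label) (vQ : (thetaIndex (pilotDataOfK T.D T.K)).VQ),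
        Set ((logShellsDH (pilotDataOfK T.D T.K) (analyticLogv T.K)).Packet j vQ))
      (ballImage : ℤ → ℤ → ∀ (j : (thetaIndex (pilotDataOfK T.D T.K)).Label) (vQ : (thetaIndex (pilotDataOfK T.D T.K)).VQ),
        Set ((logShellsDH (pilotDataOfK T.D T.K) (analyticLogv T.K)).Packet j vQ))
      (thetaDiv : ℤ → ℤ → LgpDivisor M (thetaIndex (pilotDataOfK T.D T.K)).lstar)
      (n : ℤ) {HT : Type} {LogLink : HT → HT → Type} {IsFull : ∀ {s t : HT}, LogLink s t → Prop}
      (lat : LGPGaussianLogThetaLattice LogLink IsFull)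
      {Frd : Type} {IsoF : Frd → Frd → Type} {Ob : Frd → Type} {realify : Frd → Frd} {Strip : Type}
      {IsoS : Strip → Strip → Type} {Mv : ∀ v : (thetaIndex (pilotDataOfK T.D T.K)).V, v ∈ (thetaIndex (pilotDataOfK T.D T.K)).Vbad → Type}
      [∀ v h, Monoid (Mv v h)]
      (sig : GlobalLGPFrobenioidSignature (thetaIndex (pilotDataOfK T.D T.K)).lstar (thetaIndex (pilotDataOfK T.D T.K)).V
        (· ∈ (thetaIndex (pilotDataOfK T.D T.K)).Vbad) Frd IsoF Ob realify Strip IsoS Mv)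
      (split : SplittingMonoids Mv) {ObΔ : Type} {N : ∀ v : (thetaIndex (pilotDataOfK T.D T.K)).V, v ∈ (thetaIndex (pilotDataOfK T.D T.K)).Vbad → Type}
      [∀ v h, Monoid (N v h)] (qData : QPilotData ObΔ N)
      (qK : ∀ v : (thetaIndex (pilotDataOfK T.D T.K)).V, v ∈ (thetaIndex (pilotDataOfK T.D T.K)).Vbad →
        Set ((logShellsDH (pilotDataOfK T.D T.K) (analyticLogv T.K)).StarPacket v)),
      ¬ Cor312Vol.PilotKummerCompatHull
          (LatticeSituation.ofShells (logShellsDH (pilotDataOfK T.D T.K) (analyticLogv T.K)) M archPk archSub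
            (summandPiecesPr (pilotDataOfK T.D T.K) (logvAnalytic_analyticLogv (F := T.K))).Adm
            (summandPiecesPr (pilotDataOfK T.D T.K) (logvAnalytic_analyticLogv (F := T.K))).logvol Ψ act Mmod region frobAdm frobLogvol frobΨ
            frobMmod unitImage ballImage thetaDiv)
          (settingPrVolSharp (pilotDataOfK T.D T.K) (logvAnalytic_analyticLogv (F := T.K)) M archPk archSub Ψ act Mmod region n lat sig split qData
            (exists_realising_qIdeles_pilotDataOfK T.D).choose (exists_realising_thetaIdeles_pilotDataOfK T.D).choose
            (exists_realising_qIdeles_pilotDataOfK T.D).choose_spec.1 (exists_realising_qIdeles_pilotDataOfK T.D).choose_spec.2.1)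
          (fun _ => Cor312.Setting.qRegion
            (settingPrVolSharp (pilotDataOfK T.D T.K) (logvAnalytic_analyticLogv (F := T.K)) M archPk archSub Ψ act Mmod region n lat sig split qData
              (exists_realising_qIdeles_pilotDataOfK T.D).choose (exists_realising_thetaIdeles_pilotDataOfK T.D).choose
              (exists_realising_qIdeles_pilotDataOfK T.D).choose_spec.1 (exists_realising_qIdeles_pilotDataOfK T.D).choose_spec.2.1)) qK := by
  have hodd : Odd l := hl.odd_of_ne_two (by omega)
  -- no prime strictly between 59221 and 59273 other than the five exact levels (59222…59273 \ {59233,59239,59243,59263,59273} are composite)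
  have hx : l ≤ 59221 ∨ l ∈ [59233, 59239, 59243, 59263, 59273] := by
    by_cases h : l ≤ 59221
    · exact Or.inl h
    · right
      interval_cases l <;> first | decide | exact absurd hl (by norm_num)
  have hfac : (19 * 1307 * (7 * 29 ^ 2 * 31 ^ 8) * (2 ^ 8 * 3 ^ 22 * 5 ^ 4)).factorization ((⟨31, by norm_num⟩ : Nat.Primes) : ℕ) = 8 := by
    have hp : Nat.Prime 31 := by norm_num
    have hn : 19 * 1307 * (7 * 29 ^ 2 * 31 ^ 8) * (2 ^ 8 * 3 ^ 22 * 5 ^ 4) = 31 ^ 8 * 734024930912358150240000 := by norm_num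
    have hm : ¬ 31 ∣ 734024930912358150240000 := by norm_num
    show (19 * 1307 * (7 * 29 ^ 2 * 31 ^ 8) * (2 ^ 8 * 3 ^ 22 * 5 ^ 4)).factorization 31 = 8
    rw [hn, Nat.factorization_mul (pow_ne_zero _ hp.ne_zero) (by norm_num), Finsupp.add_apply, hp.factorization_pow,
      Finsupp.single_eq_same, Nat.factorization_eq_zero_of_not_dvd hm, add_zero]
  exact GenuineK.not_pilotKummerCompatHull_chosen_triple_of_hullCells_tame DeepRegimeABC.Negative.browkinBrzezinski_isABCTriple T ⟨31, by norm_num⟩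
    (by norm_num) (by norm_num) (by norm_num) (show (31 : ℕ) ≠ l by omega) (by norm_num) hfac (i := (l - 1) / 2 - 1) (by omega)
    (fun A hA30 hA15 hAev => RefBand.cells_24833 hlo hhi hodd hx (by omega) A hA30 hA15 hAev)

end Summit.ABC.IUTFork.Conditional

end
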